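import Literature.MathematicalPhysics.QuantumFieldTheory.Balaban1985CMP102.SectB
import Literature.MathematicalPhysics.QuantumFieldTheory.Balaban1983to89.B10SectAGathering

/-!
# `Balaban3D.Proofs.Run3Zterm` — LEAF-LEDGER row C13 `ztermSucc` IN FILING SHAPE over the spine's own Z-terms
# (`SectB.TowerObjects.Zterm k h = Σ_{j<k} zcoef j · |Z_j|(h)`, typer-1): the leaf holds for ANY step pieces whose
# projection keeps the past `|Z_j|` and whose `|Z_k|` is the tower's, once the booked coefficient `zcoef k` dominates
# the gathered constant — pure bookkeeping (`Finset.sum_range_succ`)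

Lane «pub-balaban3d», seat p5; LEAF-LEDGER C13 («by R-PIECES/A8 it is by construction of p1's booked `Zterm` … p5 states
and proves it over p1's definition»).  The spine (typer-1 `SectB.TowerObjects`, rows (38)–(43)) DEFINES `Zterm` as the
printed sum of (41) p. 266 = PDF 12 L19–22 «+ Σ_{j=0}^{k−1} O(log g_j^{−1})|Z_j|» with the coefficient profile `zcoef`;
p1's `run3` fills `Hist`/`Zvol`/`zcoef` (A8: `zcoef j := (Cz+Cv)·g_j + C₅ + C₆ + (|log σ₀| + d(𝔤)·log g_j⁻¹)·c₁`, or the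
k-uniform majorant `a + b·log g_j⁻¹` of `ZtermOldOutside.gathered_le_majorant`).  No definition, no named fact.
[cite: Balaban1985UV3, (41) p.266 + p.271 L13]
-/

open scoped BigOperators

namespace Summit.QuantumFields.Balaban3D.Proofs

open Literature.MathematicalPhysics.QuantumFieldTheory.Balaban1983to89
open Literature.MathematicalPhysics.QuantumFieldTheory.Balaban1983to89.B10SectAGathering (StepPieces ZtermSucc)
open Literature.MathematicalPhysics.QuantumFieldTheory.Balaban1985CMP102.Setting (Scales)
open Literature.MathematicalPhysics.QuantumFieldTheory.Balaban1985CMP102.SectB (TowerObjects)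

variable {L : ℕ} {S : Scales L} {G : Type} [GaugeGroup G] [MeasurableSpace G] [HaarData G]

/-- **Row C13 `ztermSucc` for the spine's tower**: for `W : SectB.TowerObjects S G` and step pieces `P` over
`W.toTowerRun` at step k whose projection does not change the recorded past large-field volumes (`hpast`: |Z_j|(proj h)
= |Z_j|(h), j < k — (38) p. 266: the history at k + 1 EXTENDS the history at k) and whose `|Z_k|` is the tower's
(`hnew`), every constant `CZ ≤ zcoef k` satisfies `ZtermSucc P CZ`
(`Zterm k (proj h) + CZ·|Z_k|(h) ≤ Zterm (k+1) h = Σ_{j≤k} zcoef j·|Z_j|(h)`).  With `zcoef k :=` the gathered constant of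
`B10SectAGathering.StepLeaves.ztermSucc` (or its majorant) this is LEAF-LEDGER C13 for `run3`.
[cite: Balaban1985UV3, (41) p.266 + p.271 L13] -/
theorem ztermSucc_towerObjects (W : TowerObjects S G) {k : ℕ} (P : StepPieces W.toTowerRun k) {CZ : ℝ}
    (hpast : ∀ (h : W.Hist (k + 1)) (j : ℕ), j < k → W.Zvol k (P.proj h) j = W.Zvol (k + 1) h j)
    (hnew : ∀ h : W.Hist (k + 1), P.Zvol h = W.Zvol (k + 1) h k) (hCZ : CZ ≤ W.zcoef k) :
    ZtermSucc P CZ := by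
  intro h
  show W.Zterm k (P.proj h) + CZ * P.Zvol h ≤ W.Zterm (k + 1) h
  simp only [TowerObjects.Zterm]
  rw [Finset.sum_range_succ]
  have hsum : ∑ j ∈ Finset.range k, W.zcoef j * W.Zvol k (P.proj h) j
      = ∑ j ∈ Finset.range k, W.zcoef j * W.Zvol (k + 1) h j :=
    Finset.sum_congr rfl fun j hj => by rw [hpast h j (Finset.mem_range.mp hj)]
  rw [hsum]
  have h1 : CZ * P.Zvol h ≤ W.zcoef k * P.Zvol h := mul_le_mul_of_nonneg_right hCZ (P.Zvol_nonneg h)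
  rw [hnew h] at h1 ⊢
  linarith

end Summit.QuantumFields.Balaban3D.Proofs
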